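import Mathlib
import Summits.NavierStokesRegularity.NavierStokesRegularity.Theorems.EulerZoomLiouvillePowerGaugeEulerLiouvilleSpiralProfileEquationTools
import Summits.NavierStokesRegularity.NavierStokesRegularity.Theorems.EulerZoomLiouvillePowerGaugeEulerLiouvilleSelfSimilarPastProfileEquations
import HarnessLib

/-!
# Crux `EulerZoomLiouville.PowerGaugeEulerLiouville` (stmt-NavierStokesRegularity-19832), width sub-line `relative_equilibria`
# (ns-idea-11), R3a port recipe step P6b: the WEAK PRESSURE POISSON EQUATION of a spiral profile (slice covariance)

Route №10 `EulerZoomLiouville` (NavierStokesRegularity), crux E.  Seat ns-ezl-w2 g8 (`--supports stmt-19832 --as helper`).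
The spiral twin of `Past.profile_pressure_poisson_of_distributional` (`…SelfSimilarPastProfileEquations`): for a distributional (Euler or
Navier–Stokes) pair on the slab `(−∞,0) × ℝ³` whose slices are the origin-centred SPIRAL ansatz
`u(τ,x) = (−τ)^{γ−1} e^{(log(−τ))S} V(e^{−(log(−τ))S}((−τ)^{−γ}x))`, `p(τ,x) = (−τ)^{2(γ−1)} P(e^{−(log(−τ))S}((−τ)^{−γ}x))` (`S` skew),
with `V` a.e.-strongly measurable, `‖V‖² ∈ L¹_loc`, `P ∈ L¹_loc`:  `∫ P Δθ = −∫ D²θ(V, V)` for every `θ ∈ C_c^∞(ℝ³)`.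
Proof = ONE GOOD SLICE of the distributional pressure identity (`IsDistributionalNSSolutionOn.ae_forall_slice_pressure_identity`), tested
with the rotated–dilated test function `ψ(x) = θ(Q⁻¹(d x))` (`Q = e^{(log(−τ₀))S}`, `d = (−τ₀)^{−γ}`): the Laplacian is rotation invariant
(`laplacian_comp_linearIsometryEquiv_symm`), the Hessian transforms by `D²ψ(x)(v,v) = d² D²θ(Q⁻¹dx)(Q⁻¹v, Q⁻¹v)` and `Q⁻¹u(τ₀,x) = c V(z)`,
and the change of variables `x ↦ Q⁻¹(d x)` has constant Jacobian (rotations preserve Lebesgue measure, `Killing.integral_comp_expSkew`).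
So the Poisson equation of the spiral profile is UNCHANGED — as the line's recipe predicts («Poisson by covariance»).

WHAT THIS IS NOT: not NS, not E, no stub closed — a brick of the `Sig.stub_spiralLocData` port; 19832 OPEN.  [cite: Seregin2014, §6.3 (proof of Prop. 3.10); ChaeTsai2013DSS p. 4]
-/

noncomputable section

set_option linter.dupNamespace false

open MeasureTheory Set Filter Topology Metric Function TopologicalSpace
open scoped ENNReal NNReal InnerProductSpace RealInnerProductSpace Laplacian

namespace Summit.NavierStokesRegularity.NavierStokesRegularity.Theorems.PowerGaugeEulerLiouville

open Literature.Analysis Literature.Analysis.FunctionSpaces Literature.Analysis.FluidPDE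
open Summit.NavierStokesRegularity.NavierStokesRegularity.Theorems.CoriolisHead

namespace SpiralProfileEquation

variable {S : EuclideanSpace ℝ (Fin 3) →L[ℝ] EuclideanSpace ℝ (Fin 3)}

/-- Chain rule for the Hessian along a continuous linear map `L` of `ℝ³`: `D²(f ∘ L)(y)(v, w) = D²f(Ly)(Lv, Lw)` for `f ∈ C²`
(local copy of the two-step chain rule; cf. the tree's dilation case `fderiv_fderiv_comp_smul`). [folklore] -/
theorem fderiv_fderiv_comp_clm_apply₃ (L : EuclideanSpace ℝ (Fin 3) →L[ℝ] EuclideanSpace ℝ (Fin 3))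
    {f : EuclideanSpace ℝ (Fin 3) → ℝ} (hf : ContDiff ℝ 2 f) (y v w : EuclideanSpace ℝ (Fin 3)) :
    fderiv ℝ (fderiv ℝ (fun z => f (L z))) y v w = fderiv ℝ (fderiv ℝ f) (L y) (L v) (L w) := by
  have hfd : Differentiable ℝ f := hf.differentiable (by norm_num)
  have hDfd : Differentiable ℝ (fderiv ℝ f) :=
    (hf.fderiv_right (m := 1) (by norm_num)).differentiable (by norm_num)
  have h1 : fderiv ℝ (fun z => f (L z)) = fun z => (fderiv ℝ f (L z)).comp L := by
    funext z
    rw [show (fun z => f (L z)) = f ∘ ⇑L from rfl, fderiv_comp z (hfd (L z)) L.differentiableAt,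
      ContinuousLinearMap.fderiv]
  have hA : HasFDerivAt (fun z => fderiv ℝ f (L z)) ((fderiv ℝ (fderiv ℝ f) (L y)).comp L) y :=
    (hDfd (L y)).hasFDerivAt.comp y L.hasFDerivAt
  have hB : HasFDerivAt (fun z => (fderiv ℝ f (L z)).comp L)
      (((ContinuousLinearMap.compL ℝ (EuclideanSpace ℝ (Fin 3)) (EuclideanSpace ℝ (Fin 3)) ℝ).flip L).comp
        ((fderiv ℝ (fderiv ℝ f) (L y)).comp L)) y :=
    (((ContinuousLinearMap.compL ℝ (EuclideanSpace ℝ (Fin 3)) (EuclideanSpace ℝ (Fin 3)) ℝ).flip L).hasFDerivAt).comp y hA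
  rw [h1, hB.fderiv]
  rfl

/-- ★ **THE WEAK PRESSURE POISSON EQUATION OF A SPIRAL PROFILE.**  For a distributional (Euler or Navier–Stokes, viscosity `ν`) pair
`(u, p)` on the slab `(−∞,0) × ℝ³` whose slices are the origin-centred spiral ansatz with skew generator `S`, profile `V` (a.e.-strongly
measurable, `‖V‖² ∈ L¹_loc`) and pressure profile `P ∈ L¹_loc`: `∫ P Δθ = −∫ D²θ(V, V)` for every `θ ∈ C_c^∞(ℝ³)` — the SAME equation as
for the untwisted profile (one good slice of the distributional pressure identity, undone by the rotated dilation `y = e^{−(log(−τ₀))S}(−τ₀)^{−γ}x`).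
[cite: Seregin2014, §6.3 (proof of Prop. 3.10)] -/
theorem spiral_profile_pressure_poisson {γ ν : ℝ} (hS : ∀ x y : EuclideanSpace ℝ (Fin 3), ⟪S x, y⟫ = -⟪x, S y⟫)
    {u : ℝ → EuclideanSpace ℝ (Fin 3) → EuclideanSpace ℝ (Fin 3)} {p : ℝ → EuclideanSpace ℝ (Fin 3) → ℝ}
    {V : EuclideanSpace ℝ (Fin 3) → EuclideanSpace ℝ (Fin 3)} {P : EuclideanSpace ℝ (Fin 3) → ℝ}
    (hsol : IsDistributionalNSSolutionOn (slab (EuclideanSpace ℝ (Fin 3)) (Iio 0) isOpen_Iio) ν 0 u p)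
    (hVm : AEStronglyMeasurable V volume)
    (hu : ∀ τ : ℝ, τ < 0 → u τ = fun x => (-τ) ^ (γ - 1) • NormedSpace.exp ((Real.log (-τ)) • S)
      (V (NormedSpace.exp ((-Real.log (-τ)) • S) ((-τ) ^ (-γ) • x))))
    (hp : ∀ τ : ℝ, τ < 0 → p τ = fun x => (-τ) ^ (2 * (γ - 1)) *
      P (NormedSpace.exp ((-Real.log (-τ)) • S) ((-τ) ^ (-γ) • x)))
    (hV2 : LocallyIntegrable (fun y => ‖V y‖ ^ 2) volume) (hP1 : LocallyIntegrable P volume)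
    {θ : EuclideanSpace ℝ (Fin 3) → ℝ} (hθ : ContDiff ℝ (⊤ : ℕ∞) θ) (hθc : HasCompactSupport θ) :
    ∫ y, P y * (Δ θ) y = -∫ y, fderiv ℝ (fderiv ℝ θ) y (V y) (V y) := by
  -- the proof of `Past.profile_pressure_poisson_of_distributional`, with the rotation threaded through
  have hB := Spiral.inner_self_of_skew hS
  -- restrict the distributional solution to the product region `(−2,−1) × ℝ³`
  set Q : Opens (ℝ × EuclideanSpace ℝ (Fin 3)) :=
    ⟨Ioo (-2 : ℝ) (-1) ×ˢ ((⊤ : Opens (EuclideanSpace ℝ (Fin 3))) : Set (EuclideanSpace ℝ (Fin 3))),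
      isOpen_Ioo.prod (⊤ : Opens (EuclideanSpace ℝ (Fin 3))).isOpen⟩ with hQ
  have hQle : Q ≤ slab (EuclideanSpace ℝ (Fin 3)) (Iio 0) isOpen_Iio := by
    intro z hz
    have hz' : z ∈ Ioo (-2 : ℝ) (-1) ×ˢ ((⊤ : Opens (EuclideanSpace ℝ (Fin 3))) :
        Set (EuclideanSpace ℝ (Fin 3))) := hz
    have h12 := (mem_prod.1 hz').1.2
    exact mem_slab.2 (show z.1 < 0 by linarith)
  have hns : IsDistributionalNSSolutionOn Q ν 0 u p := hsol.of_le hQle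
  have hslice := IsDistributionalNSSolutionOn.ae_forall_slice_pressure_identity
    (a := -2) (b := -1) (Ω := (⊤ : Opens (EuclideanSpace ℝ (Fin 3)))) hns
    (by
      have e : (uncurry (0 : ℝ → EuclideanSpace ℝ (Fin 3) → EuclideanSpace ℝ (Fin 3))) =
          fun _ => 0 := by funext z; rfl
      rw [e]; exact locallyIntegrableOn_zero) (fun φ _ => by simp)
  -- a good time
  have hne : (ae ((volume : Measure ℝ).restrict (Ioo (-2 : ℝ) (-1)))).NeBot := by
    rw [ae_neBot, Ne, Measure.restrict_eq_zero, Real.volume_Ioo]; norm_num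
  obtain ⟨τ₀, hτ₀, hτ₀I⟩ := (hslice.and (ae_restrict_mem measurableSet_Ioo)).exists
  have hτ₀0 : τ₀ < 0 := by have := hτ₀I.2; linarith
  have hs : 0 < -τ₀ := neg_pos.2 hτ₀0
  set c : ℝ := (-τ₀) ^ (γ - 1) with hc
  set d : ℝ := (-τ₀) ^ (-γ) with hd
  have hc0 : 0 < c := Real.rpow_pos_of_pos hs _
  have hd0 : 0 < d := Real.rpow_pos_of_pos hs _
  -- the rotation `R = e^{(log(−τ₀))S}`, `R⁻¹ = e^{−(log(−τ₀))S}` as a linear isometry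
  obtain ⟨R, hR, hRs⟩ := rss_exists_rot hB (-Real.log (-τ₀))
  have hR' : ∀ y, R y = NormedSpace.exp ((Real.log (-τ₀)) • S) y := fun y => by rw [hR, neg_neg]
  have huτ : u τ₀ = fun x => c • R (V (R.symm (d • x))) := by
    rw [hu τ₀ hτ₀0]; funext x; rw [hR', hRs]
  have hpτ : p τ₀ = fun x => (-τ₀) ^ (2 * (γ - 1)) * P (R.symm (d • x)) := by
    rw [hp τ₀ hτ₀0]; funext x; rw [hRs]
  have hc2 : (-τ₀) ^ (2 * (γ - 1)) = c ^ 2 := by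
    rw [hc, ← Real.rpow_natCast ((-τ₀) ^ (γ - 1)) 2, ← Real.rpow_mul hs.le]
    congr 1; push_cast; ring
  -- the slice map `x ↦ R⁻¹(d x)` preserves the measure class and local integrability
  have hqmp : Measure.QuasiMeasurePreserving (fun x : EuclideanSpace ℝ (Fin 3) => R.symm (d • x)) volume volume :=
    R.symm.measurePreserving.quasiMeasurePreserving.comp (quasiMeasurePreserving_smul hd0.ne')
  have hlocR : ∀ {F' : Type} [NormedAddCommGroup F'] {g : EuclideanSpace ℝ (Fin 3) → F'},
      LocallyIntegrable g volume → LocallyIntegrable (fun x => g (R.symm (d • x))) volume := by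
    intro F' _ g hg
    have h1 : LocallyIntegrable (fun y => g (R.symm y)) volume := by
      have e : (fun y => g (R.symm y)) = fun y => g (NormedSpace.exp ((-Real.log (-τ₀)) • S) y) := by
        funext y; rw [hRs]
      rw [e]; exact Killing.locallyIntegrable_comp_expSkew hB _ hg
    exact locallyIntegrable_comp_smul h1 hd0.ne'
  -- the slice side conditions at `τ₀`
  have h1 : AEStronglyMeasurable (u τ₀)
      (volume.restrict ((⊤ : Opens (EuclideanSpace ℝ (Fin 3))) : Set (EuclideanSpace ℝ (Fin 3)))) := by
    rw [Opens.coe_top, Measure.restrict_univ, huτ]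
    exact (R.continuous.comp_aestronglyMeasurable (hVm.comp_quasiMeasurePreserving hqmp)).const_smul c
  have h2 : LocallyIntegrableOn (fun x => ‖u τ₀ x‖ ^ 2)
      ((⊤ : Opens (EuclideanSpace ℝ (Fin 3))) : Set (EuclideanSpace ℝ (Fin 3))) volume := by
    rw [Opens.coe_top, locallyIntegrableOn_univ, huτ]
    have h := (hlocR hV2).smul (c ^ 2)
    refine h.congr (Eventually.of_forall fun x => ?_)
    simp only [Pi.smul_apply, smul_eq_mul, norm_smul, Real.norm_eq_abs, abs_of_pos hc0, LinearIsometryEquiv.norm_map]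
    ring
  have h3 : LocallyIntegrableOn (p τ₀)
      ((⊤ : Opens (EuclideanSpace ℝ (Fin 3))) : Set (EuclideanSpace ℝ (Fin 3))) volume := by
    rw [Opens.coe_top, locallyIntegrableOn_univ, hpτ]
    have h := (hlocR hP1).smul ((-τ₀) ^ (2 * (γ - 1)))
    refine h.congr (Eventually.of_forall fun x => ?_)
    simp only [Pi.smul_apply, smul_eq_mul]
  have key := hτ₀ h1 h2 h3
  -- the rotated–dilated test function `ψ = θ(R⁻¹(d ·))`
  set θR : EuclideanSpace ℝ (Fin 3) → ℝ := fun y => θ (R.symm y) with hθR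
  have hθRd : ContDiff ℝ (⊤ : ℕ∞) θR := hθ.comp R.symm.toContinuousLinearEquiv.contDiff
  have hθRc : HasCompactSupport θR := hθc.comp_homeomorph R.symm.toHomeomorph
  set ψ : EuclideanSpace ℝ (Fin 3) → ℝ := fun x => θR (d • x) with hψ
  have hψT : IsTestFunctionOn (⊤ : Opens (EuclideanSpace ℝ (Fin 3))) ψ :=
    ⟨hθRd.comp (contDiff_const_smul d), hθRc.comp_smul hd0.ne', by simp⟩
  have hid := key ψ hψT
  -- Laplacian and Hessian of the rotated–dilated test function
  have hΔψ : ∀ x, Δ ψ x = d ^ 2 * (Δ θ) (R.symm (d • x)) := fun x => by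
    have h1 := laplacian_comp_smul_eq θR d x
    have h2 := laplacian_comp_linearIsometryEquiv_symm R θ (d • x)
    rw [hψ, h1, smul_eq_mul, ← h2]
  have hθ2 : ContDiff ℝ 2 θ := hθ.of_le (by norm_cast)
  have hHψ : ∀ x (v : EuclideanSpace ℝ (Fin 3)),
      fderiv ℝ (fderiv ℝ ψ) x v v = d ^ 2 * fderiv ℝ (fderiv ℝ θ) (R.symm (d • x)) (R.symm v) (R.symm v) := fun x v => by
    rw [hψ, fderiv_fderiv_comp_smul θR d]
    show (d ^ 2 • fderiv ℝ (fderiv ℝ θR) (d • x)) v v = _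
    have e : θR = fun z => θ ((R.symm : EuclideanSpace ℝ (Fin 3) →L[ℝ] EuclideanSpace ℝ (Fin 3)) z) := by
      rw [hθR]; rfl
    rw [smul_apply, smul_apply, smul_eq_mul, e,
      fderiv_fderiv_comp_clm_apply₃ (R.symm : EuclideanSpace ℝ (Fin 3) →L[ℝ] EuclideanSpace ℝ (Fin 3)) hθ2]
    rfl
  -- change of variables `x ↦ R⁻¹(d x)`: dilation, then rotation
  have hvol : |((d ^ Module.finrank ℝ (EuclideanSpace ℝ (Fin 3)))⁻¹)| = (d ^ 3)⁻¹ := by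
    rw [finrank_euclideanSpace_fin, abs_of_pos (by positivity)]
  have hcov : ∀ F : EuclideanSpace ℝ (Fin 3) → ℝ, ∫ x, F (R.symm (d • x)) = (d ^ 3)⁻¹ * ∫ y, F y := by
    intro F
    have h := Measure.integral_comp_smul volume (fun y => F (R.symm y)) d
    simp only [hvol, smul_eq_mul] at h
    rw [h]
    congr 1
    have e : (fun y => F (R.symm y)) = fun y => F (NormedSpace.exp ((-Real.log (-τ₀)) • S) y) := by
      funext y; rw [hRs]
    rw [e, Killing.integral_comp_expSkew hB]
  have hL : ∫ x, p τ₀ x * Δ ψ x = c ^ 2 * d ^ 2 * ((d ^ 3)⁻¹ * ∫ y, P y * (Δ θ) y) := by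
    have e : (fun x => p τ₀ x * Δ ψ x) =
        fun x => (c ^ 2 * d ^ 2) * ((fun y => P y * (Δ θ) y) (R.symm (d • x))) := by
      funext x; rw [hpτ, hΔψ, hc2]; ring
    rw [e, integral_const_mul]
    congr 1
    exact hcov (fun y => P y * (Δ θ) y)
  have hR2 : ∫ x, fderiv ℝ (fderiv ℝ ψ) x (u τ₀ x) (u τ₀ x) =
      c ^ 2 * d ^ 2 * ((d ^ 3)⁻¹ * ∫ y, fderiv ℝ (fderiv ℝ θ) y (V y) (V y)) := by
    have e : (fun x => fderiv ℝ (fderiv ℝ ψ) x (u τ₀ x) (u τ₀ x)) =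
        fun x => (c ^ 2 * d ^ 2) *
          ((fun y => fderiv ℝ (fderiv ℝ θ) y (V y) (V y)) (R.symm (d • x))) := by
      funext x
      have hRu : ∀ w : EuclideanSpace ℝ (Fin 3), R.symm (c • R w) = c • w := fun w => by
        rw [map_smul, LinearIsometryEquiv.symm_apply_apply]
      rw [huτ, hHψ]
      beta_reduce
      rw [hRu, bilin_apply_smul_self]
      ring
    rw [e, integral_const_mul]
    congr 1
    exact hcov (fun y => fderiv ℝ (fderiv ℝ θ) y (V y) (V y))
  rw [hL, hR2] at hid
  have hcd : c ^ 2 * d ^ 2 * (d ^ 3)⁻¹ ≠ 0 := by positivity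
  have hid' : c ^ 2 * d ^ 2 * (d ^ 3)⁻¹ * ∫ y, P y * (Δ θ) y =
      c ^ 2 * d ^ 2 * (d ^ 3)⁻¹ * (-∫ y, fderiv ℝ (fderiv ℝ θ) y (V y) (V y)) := by
    linarith
  exact mul_left_cancel₀ hcd hid'

end SpiralProfileEquation

end Summit.NavierStokesRegularity.NavierStokesRegularity.Theorems.PowerGaugeEulerLiouville

end
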